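import Literature.NumberTheory.EllipticCurves.BDPAnticyclotomicPAdicLFunction
import HarnessLib

/-!
# `rankinSelbergValueHecke f φ s₀`: the junk branch, made explicit (proofs only)

`rankinSelbergValueHecke f φ s₀` (`BDPAnticyclotomicPAdicLFunction.lean`) is "the unique `L₀` such that
every entire `L` agreeing with the Euler product `rankinSelbergEulerProductHecke f φ s` on the FIXED
half-plane `re s > 3/2` takes the value `L₀` at `s₀`", and `0` when that `L₀` is not unique. Its
docstring restricts the intended use to UNITARY `φ` ("e.g. anticyclotomic of infinity type `(−n, n)`,
`|φ(ϖ_v)| = 1` — absolutely convergent for `re s > 3/2`"). This file records, as theorems, what the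
definition returns when NO entire function agrees with the Euler product on `re s > 3/2`: then
`IsRankinSelbergValueHecke f φ s₀ L₀` holds for EVERY `L₀` (`isRankinSelbergValueHecke_of_forall_not_agree`),
uniqueness fails, and `rankinSelbergValueHecke f φ s₀ = 0` (`rankinSelbergValueHecke_eq_zero_of_forall_not_agree`).

WHY IT MATTERS (typing-layer note, cell `pub/bsd-littype`, 2026-08-27): for a Hecke character `φ` of the
tree's infinity type `(P, Q)` one has `|φ(ϖ_w)| = Nw^{(P+Q)/2}` (`hasInfinityType_normCharacter`: the
idelic norm has type `(−1, −1)` and `|ϖ_w|_𝔸 = Nw⁻¹`; type `(t, −t)` is unitary), so for `P + Q > 0` the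
Euler product converges absolutely only for `re s > 3/2 + (P+Q)/2` and is Mathlib-junk (`tprod` of a
non-multipliable family, or a product tending to `0`) on the band `3/2 < re s < 3/2 + (P+Q)/2`; no entire
function agrees with it there, and the value returned at ANY `s₀` is the junk `0` of this file — not
`L(f/K, φ, s₀)`. Interpolation frames over NON-unitary ranges (Hida's `Σ^{(2)}, Σ^{(2′)}` characters of
type `(a, b)` with `a + b ≠ 0` in the tree's convention, e.g. CGS25 Thm. 2.4.1 / LLZ15 Thm. 6.1.3 /
Yan–Zhu 2026 Thm. 3.9) must therefore bind the `L`-value through an entire continuation from a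
half-plane of absolute convergence (as `CastellaGrossiSkinner2025.IsHidaRankinLFunctionII` does, from
`re s > c + 2`), never through `rankinSelbergValueHecke`. No analytic fact is proved here (the divergence
statement above is classical analytic number theory, [cite: Nekovar1995, §1.6–1.7 (the continuation and its half-plane)]);
the two theorems below are pure logic on the tree's definitions.

## References
* [Nekovar1995] J. Nekovář, Math. Ann. 302 (1995), (0.5) and §1.6–1.7 (the Rankin–Selberg
  `L`-function, its Euler product for `re s > 3/2` in the unitary normalisation, continuation).
* [Castella2018] F. Castella, Thm. 3.1 (the unitary use: anticyclotomic `φ` of type `(−n, n)`).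
-/

noncomputable section

open scoped MatrixGroups ModularForm
open CongruenceSubgroup NumberField IsDedekindDomain
open Literature.NumberTheory.GaloisRepresentations

namespace Literature.NumberTheory.EllipticCurves

universe u

variable {K : Type u} [Field K] [NumberField K] {N : ℕ}

/-- **Vacuity.** If no entire function agrees with the Euler product
`rankinSelbergEulerProductHecke f φ s` on the half-plane `re s > 3/2`, then EVERY complex number `L₀`
satisfies `IsRankinSelbergValueHecke f φ s₀ L₀` (the defining `∀ L, … → L s₀ = L₀` is vacuous).
[cite: Nekovar1995, §1.6–1.7] -/
theorem isRankinSelbergValueHecke_of_forall_not_agree {f : CuspForm (Gamma0 N) 2}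
    {φ : HeckeCharacter K}
    (h : ∀ L : ℂ → ℂ, Differentiable ℂ L →
      ¬ ∀ s : ℂ, 3 / 2 < s.re → L s = rankinSelbergEulerProductHecke f φ s)
    (s₀ L₀ : ℂ) : IsRankinSelbergValueHecke f φ s₀ L₀ :=
  fun L hL hagree => (h L hL hagree).elim

/-- **No uniqueness in the vacuous case**: then both `0` and `1` qualify, so there is no unique
value. [cite: Nekovar1995, §1.6–1.7] -/
theorem not_existsUnique_isRankinSelbergValueHecke_of_forall_not_agree {f : CuspForm (Gamma0 N) 2}
    {φ : HeckeCharacter K}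
    (h : ∀ L : ℂ → ℂ, Differentiable ℂ L →
      ¬ ∀ s : ℂ, 3 / 2 < s.re → L s = rankinSelbergEulerProductHecke f φ s)
    (s₀ : ℂ) : ¬ ∃! L₀ : ℂ, IsRankinSelbergValueHecke f φ s₀ L₀ := by
  rintro ⟨L₀, -, huniq⟩
  have h0 : (0 : ℂ) = L₀ := huniq 0 (isRankinSelbergValueHecke_of_forall_not_agree h s₀ 0)
  have h1 : (1 : ℂ) = L₀ := huniq 1 (isRankinSelbergValueHecke_of_forall_not_agree h s₀ 1)
  exact zero_ne_one (h0.trans h1.symm)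

/-- **The junk branch.** If no entire function agrees with the Euler product on `re s > 3/2` — the
situation for every NON-unitary `φ` whose values grow, `|φ(ϖ_w)| = Nw^{c}` with `c > 0` (module
docstring) — then `rankinSelbergValueHecke f φ s₀ = 0` for every `s₀`: the definition's `dif` takes the
`else 0` branch. [cite: Nekovar1995, §1.6–1.7] -/
theorem rankinSelbergValueHecke_eq_zero_of_forall_not_agree {f : CuspForm (Gamma0 N) 2}
    {φ : HeckeCharacter K}
    (h : ∀ L : ℂ → ℂ, Differentiable ℂ L →
      ¬ ∀ s : ℂ, 3 / 2 < s.re → L s = rankinSelbergEulerProductHecke f φ s)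
    (s₀ : ℂ) : rankinSelbergValueHecke f φ s₀ = 0 := by
  classical
  unfold rankinSelbergValueHecke
  exact dif_neg (not_existsUnique_isRankinSelbergValueHecke_of_forall_not_agree h s₀)

/-- Conversely, when SOME entire function agrees with the Euler product on `re s > 3/2` (the unitary
situation of Castella 2018 Thm. 3.1 / Nekovář), the qualifying value is unique and is that function's
value: `rankinSelbergValueHecke f φ s₀ = L s₀`. [cite: Nekovar1995, §1.6–1.7] [cite: Castella2018, Thm. 3.1] -/
theorem rankinSelbergValueHecke_eq_of_agree {f : CuspForm (Gamma0 N) 2} {φ : HeckeCharacter K}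
    {L : ℂ → ℂ} (hL : Differentiable ℂ L)
    (hagree : ∀ s : ℂ, 3 / 2 < s.re → L s = rankinSelbergEulerProductHecke f φ s) (s₀ : ℂ) :
    rankinSelbergValueHecke f φ s₀ = L s₀ := by
  classical
  have hval : IsRankinSelbergValueHecke f φ s₀ (L s₀) := by
    intro L₁ hL₁ hagree₁
    rw [eq_of_isEntireContinuation_rankinSelbergHecke hL hagree hL₁ hagree₁]
  have huniq : ∃! L₀ : ℂ, IsRankinSelbergValueHecke f φ s₀ L₀ :=
    ⟨L s₀, hval, fun L₀ hL₀ => (hL₀ L hL hagree).symm⟩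
  exact ((isRankinSelbergValueHecke_rankinSelbergValueHecke huniq) L hL hagree).symm

end Literature.NumberTheory.EllipticCurves
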